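import Summits.AtomisticToContinuum.Crystallization.Theorems.OverbindingBudgetMisfitWindowStatements

/-!
# OverbindingBudget — «MisfitWindow», part 2/3: the off-window sites of a chunk lie in its boundary layer
(decomp-a2c lens-4, generation 39)

Helper file (`--supports stmt-AtomisticToContinuum-31280`); imports part 1 (`…MisfitWindowStatements`).

THE DOMAIN-OF-USE LEMMA (`offCount_chunk_le`, PROVED, pure geometry).  `Y ⊆ ℝ³` is `δ`-separated and `9/10`-covering; `y` enumerates
injectively the chunk `Y ∩ {o ≤ z < o + ℓ}` with `o = (−2, −2, −2)`, `ℓ = m + 4 ≥ δ`, `N ≥ 2` sites.  Then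
  * every site has nearest-neighbour distance `≥ δ` (separation; `le_nearestDist`);
  * every site with `0 ≤ y_i < m` coordinatewise has nearest-neighbour distance `≤ 19/10 ≤ 2`: the covering witness `w ∈ Y` of the point
    `y_i + e₀` (`e₀ = PiLp.single 2 0 1`, `‖e₀‖ = 1`) lies in the cube, is a chunk site, is not `y_i` (it is within `9/10` of a point at
    distance `1` from `y_i`), and is within `1 + 9/10` of `y_i`;
  * hence the sites with `nn ∉ [δ, 2]` lie in the six boundary slabs `{y_i k < 0}`, `{m ≤ y_i k}` of width `2`, each holding at most
    `(4/δ + 1)(3ℓ/δ)²` points (`card_le_of_slab`, from `…CubeTails.card_le_of_separated_of_box`):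

        offCount δ 2 y ≤ 54 (4/δ + 1) δ⁻² · ℓ².

This is the only geometric input part 3 adds to the g37 glue.  Reference-free; axioms `propext`, `Classical.choice`, `Quot.sound` only.
-/

namespace Summit.AtomisticToContinuum.Crystallization.Theorems.OverbindingBudgetMisfitWindowLayer

open Filter Metric Set Topology
open scoped BigOperators
open Literature.MathematicalPhysics.StatisticalMechanics
open Literature.Geometry.DiscreteGeometry (IsChargeFree bondGraph nearestDist nearestDist_le_dist nearestDist_nonneg le_nearestDist bondGraph_adj)
open Summit.AtomisticToContinuum.Crystallization.Theses.OverbindingBudget (RobustDefectLimitWindows)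
open Summit.AtomisticToContinuum.Crystallization.Theses.PricedLinkCensus (ChargedEnergyGap)
open Summit.AtomisticToContinuum.Crystallization.Theorems.OverbindingBudgetCubeTails (card_le_of_separated_of_box)
open Summit.AtomisticToContinuum.Crystallization.Theorems.OverbindingBudgetGradedBareness (CleanlessExcessT)
open Summit.AtomisticToContinuum.Crystallization.Theorems.OverbindingBudgetCoherentCut (CoherentResidual)
open Summit.AtomisticToContinuum.Crystallization.Theorems.OverbindingBudgetViolatorDensityFloor (RT)
open Summit.AtomisticToContinuum.Crystallization.Theorems.OverbindingBudgetRecurrentDustStatements (ViolatorsL rt_mono window_finite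
  window_finite_lt)
open Summit.AtomisticToContinuum.Crystallization.Theorems.OverbindingBudgetBindingSignLaw (grid_lower_bound)
open Summit.AtomisticToContinuum.Crystallization.Theorems.OverbindingBudgetExcessInstability (finite_inter_cube)
open Summit.AtomisticToContinuum.Crystallization.Theorems.OverbindingBudgetEdgeRelaxationStatements (CleanClass StrainedCubes)
open Summit.AtomisticToContinuum.Crystallization.Theorems.OverbindingBudgetElasticSplitStatements (chargedCount DenseCharge SparseCharge)
open Summit.AtomisticToContinuum.Crystallization.Theorems.OverbindingBudgetElasticSplitPricing (rpow_two_thirds_le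
  two_mul_interactionEnergy_eq_sum_sum_image groundStateEnergy_le_eventually)
open Summit.AtomisticToContinuum.Crystallization.Theorems.OverbindingBudgetGrossMargin (GrossLiouvilleLaw)
open Summit.AtomisticToContinuum.Crystallization.Theorems.OverbindingBudgetMisfitCensusStatements (Bad Short Long Gap badCount scaleCount
  gapCount MisfitEnergyGap ScaleEnergyGap GapEnergyGap GapFreeShells bad_cases badCount_le_scaleCount_add_gapCount
  badCount_le_scaleCount_of_gapFree rt_of_local card_le_of_cube MisfitRelax)
open Summit.AtomisticToContinuum.Crystallization.Theorems.OverbindingBudgetMisfitCensus (rdef_of_ceg_misfitRelax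
  grossLiouvilleLaw_of_misfitRelax)
open Summit.AtomisticToContinuum.Crystallization.Theorems.OverbindingBudgetMisfitRegistration (Framed Reg DeepReg NearCharge regScaleCount
  unregCount nearChargeCount RegisteredScaleGap NearChargeGap nearCharge_of_not_framed nearCharge_of_not_deepReg)
open Summit.AtomisticToContinuum.Crystallization.Theorems.OverbindingBudgetTwoShellShape (TwoShellShape)
open Summit.AtomisticToContinuum.Crystallization.Theorems.OverbindingBudgetMisfitWindowStatements (InWindow offCount rimCount ScaleEnergyGapW
  MisfitEnergyGapW GapEnergyGapW TameScaleGap TameMisfitGap tameScaleGap_of_scaleEnergyGap tameMisfitGap_of_misfitEnergyGap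
  tameMisfitGap_of_tameScale_gap tameMisfitGap_zero_of_tameScale_gapFree tameScaleGap_of_registered scaleEnergyGapW_of_registered)

/-! ## §F  Slabs: the boundary layer of a chunk is thin (PROVED) -/

/-- Packing in a slab: a `δ`-separated finite set in a half-open box with side `w` in direction `k` and `ℓ` in the other two (`δ ≤ ℓ`,
`0 ≤ w`) has at most `(2w/δ + 1)(3ℓ/δ)²` points (`…CubeTails.card_le_of_separated_of_box`). [this file] -/
theorem card_le_of_slab {F : Finset (EuclideanSpace ℝ (Fin 3))} {lo : Fin 3 → ℝ} {k : Fin 3} {ℓ w δ : ℝ} (hδ : 0 < δ) (hδℓ : δ ≤ ℓ)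
    (hw : 0 ≤ w) (hmem : ∀ z ∈ F, ∀ i : Fin 3, lo i ≤ z i ∧ z i < lo i + (if i = k then w else ℓ))
    (hsep : ∀ z ∈ F, ∀ z' ∈ F, z ≠ z' → δ ≤ dist z z') : (F.card : ℝ) ≤ (2 * w / δ + 1) * (3 * ℓ / δ) ^ 2 := by
  have hℓpos : 0 < ℓ := lt_of_lt_of_le hδ hδℓ
  have hL : ∀ i : Fin 3, (0 : ℝ) ≤ (fun i : Fin 3 => if i = k then w else ℓ) i := by
    intro i
    dsimp only
    split_ifs
    · exact hw
    · exact hℓpos.le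
  have hbox := card_le_of_separated_of_box F lo (fun i => if i = k then w else ℓ) hδ hL hmem hsep
  have hprod : ∏ i : Fin 3, (2 * (fun i : Fin 3 => if i = k then w else ℓ) i / δ + 1) = (2 * w / δ + 1) * (2 * ℓ / δ + 1) ^ 2 := by
    rw [← Finset.mul_prod_erase Finset.univ (fun i : Fin 3 => 2 * (fun i : Fin 3 => if i = k then w else ℓ) i / δ + 1) (Finset.mem_univ k)]
    dsimp only
    rw [if_pos rfl]
    congr 1
    rw [Finset.prod_congr rfl (g := fun _ => 2 * ℓ / δ + 1) (fun i hi => by rw [if_neg (Finset.ne_of_mem_erase hi)]),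
      Finset.prod_const, Finset.card_erase_of_mem (Finset.mem_univ k), Finset.card_univ, Fintype.card_fin]
  rw [hprod] at hbox
  have h3 : 2 * ℓ / δ + 1 ≤ 3 * ℓ / δ := by
    rw [div_add_one (ne_of_gt hδ), div_le_div_iff_of_pos_right hδ]
    linarith
  have h30 : 0 ≤ 2 * ℓ / δ + 1 := by positivity
  have hw0 : 0 ≤ 2 * w / δ + 1 := by positivity
  calc (F.card : ℝ) ≤ (2 * w / δ + 1) * (2 * ℓ / δ + 1) ^ 2 := hbox
    _ ≤ (2 * w / δ + 1) * (3 * ℓ / δ) ^ 2 := mul_le_mul_of_nonneg_left (pow_le_pow_left₀ h30 h3 2) hw0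

/-- **The off-window sites of a chunk lie in its boundary layer.**  `Y` is `δ`-separated (`0 < δ ≤ ℓ`) and `9/10`-covering, `y` an
injective enumeration with `N ≥ 2` of the chunk `Y ∩ {o ≤ z < o + ℓ}`, `o = (−2,−2,−2)`, `ℓ = m + 4`: every site has `nn ≥ δ`, every site
with `0 ≤ y_i < m` coordinatewise has `nn ≤ 2`, so the sites with `nn ∉ [δ, 2]` lie in six slabs of width `2`:
`#off(δ, 2) ≤ 54 (4/δ + 1) δ⁻² ℓ²`. [this file] -/
theorem offCount_chunk_le {Y : Set (EuclideanSpace ℝ (Fin 3))} {δ ℓ m : ℝ} {o : EuclideanSpace ℝ (Fin 3)} {N : ℕ}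
    {y : Fin N → EuclideanSpace ℝ (Fin 3)} (hδ : 0 < δ) (hℓδ : δ ≤ ℓ) (hsep : ∀ z ∈ Y, ∀ w ∈ Y, z ≠ w → δ ≤ dist z w)
    (hcov : ∀ z : EuclideanSpace ℝ (Fin 3), ∃ w ∈ Y, dist z w ≤ 9 / 10) (hoi : ∀ i : Fin 3, o i = -2) (hℓ : ℓ = m + 4)
    (hy : Function.Injective y) (hr : Set.range y = Y ∩ {z | ∀ i : Fin 3, o i ≤ z i ∧ z i < o i + ℓ}) (hN2 : 2 ≤ N) :
    (offCount δ 2 y : ℝ) ≤ 54 * (4 / δ + 1) / δ ^ 2 * ℓ ^ 2 := by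
  classical
  have hyY : ∀ i : Fin N, y i ∈ Y ∧ ∀ k : Fin 3, o k ≤ y i k ∧ y i k < o k + ℓ := fun i => by
    have h : y i ∈ Set.range y := ⟨i, rfl⟩
    rw [hr] at h
    exact h
  haveI : Nontrivial (Fin N) := Fin.nontrivial_iff_two_le.2 hN2
  -- every chunk site has `nn ≥ δ`
  have hnnlo : ∀ i : Fin N, δ ≤ nearestDist y i := by
    intro i
    refine le_nearestDist (exists_ne i) (fun k hk => ?_)
    exact hsep (y i) (hyY i).1 (y k) (hyY k).1 (fun h => hk (hy h).symm)
  -- a chunk site two units inside the cube has `nn ≤ 2` (covering witness of `y i + e₀`)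
  set e3 : EuclideanSpace ℝ (Fin 3) := PiLp.single 2 (0 : Fin 3) (1 : ℝ) with he3
  have hne3 : ‖e3‖ = 1 := by rw [he3, PiLp.norm_single, norm_one]
  have he3k : ∀ k : Fin 3, 0 ≤ e3 k ∧ e3 k ≤ 1 := by
    intro k
    rw [he3, PiLp.single_apply]
    split_ifs <;> norm_num
  have hnnhi : ∀ i : Fin N, (∀ k : Fin 3, 0 ≤ y i k ∧ y i k < m) → nearestDist y i ≤ 2 := by
    intro i hin
    obtain ⟨w, hw, hzw⟩ := hcov (y i + e3)
    have hwF : w ∈ Set.range y := by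
      rw [hr]
      refine ⟨hw, fun k => ?_⟩
      have hk : |(y i + e3) k - w k| ≤ dist (y i + e3) w := by
        rw [← Real.dist_eq]
        exact PiLp.dist_apply_le (y i + e3) w k
      have habs := abs_le.1 (hk.trans hzw)
      have hadd : (y i + e3) k = y i k + e3 k := rfl
      have hik := hin k
      rw [hoi, hℓ]
      obtain ⟨he0, he1⟩ := he3k k
      rw [hadd] at habs
      constructor <;> linarith [habs.1, habs.2, hik.1, hik.2]
    obtain ⟨k', hk'⟩ := hwF
    have hd1 : dist (y i + e3) (y i) = 1 := by rw [dist_self_add_left, hne3]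
    have hne : k' ≠ i := by
      intro h
      rw [h] at hk'
      rw [← hk'] at hzw
      linarith [hd1, hzw]
    calc nearestDist y i ≤ dist (y i) (y k') := nearestDist_le_dist y hne
      _ ≤ dist (y i) (y i + e3) + dist (y i + e3) (y k') := dist_triangle _ _ _
      _ ≤ 1 + 9 / 10 := by rw [dist_comm (y i), hd1, hk']; linarith
      _ ≤ 2 := by norm_num
  -- six slabs of indices
  set Off : Finset (Fin N) := Finset.univ.filter (fun i => ¬ InWindow δ 2 y i) with hOff
  set Lo : Fin 3 → Finset (Fin N) := fun k => Finset.univ.filter (fun i => y i k < 0) with hLo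
  set Hi : Fin 3 → Finset (Fin N) := fun k => Finset.univ.filter (fun i => m ≤ y i k) with hHi
  have hcov6 : Off ⊆ Finset.univ.biUnion (fun k => Lo k ∪ Hi k) := by
    intro i hi
    rw [hOff, Finset.mem_filter] at hi
    have hnin : ¬ ∀ k : Fin 3, 0 ≤ y i k ∧ y i k < m := fun hin => hi.2 ⟨hnnlo i, hnnhi i hin⟩
    push Not at hnin
    obtain ⟨k, hk⟩ := hnin
    rw [Finset.mem_biUnion]
    refine ⟨k, Finset.mem_univ _, ?_⟩
    rw [Finset.mem_union]
    by_cases h0 : y i k < 0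
    · exact Or.inl (Finset.mem_filter.2 ⟨Finset.mem_univ _, h0⟩)
    · right
      push Not at h0
      exact Finset.mem_filter.2 ⟨Finset.mem_univ _, hk h0⟩
  have hslab : ∀ k : Fin 3,
      ((Lo k).card : ℝ) ≤ (2 * 2 / δ + 1) * (3 * ℓ / δ) ^ 2 ∧ ((Hi k).card : ℝ) ≤ (2 * 2 / δ + 1) * (3 * ℓ / δ) ^ 2 := by
    intro k
    constructor
    · rw [← Finset.card_image_of_injective (Lo k) hy]
      refine card_le_of_slab (lo := fun i => o i) (k := k) hδ hℓδ (by norm_num) (fun z hz i => ?_) (fun z hz w hw hzw => ?_)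
      · obtain ⟨j, hj, rfl⟩ := Finset.mem_image.1 hz
        have hjk : y j k < 0 := (Finset.mem_filter.1 hj).2
        have hzi := (hyY j).2 i
        by_cases hik : i = k
        · subst hik
          rw [if_pos rfl, hoi]
          rw [hoi] at hzi
          exact ⟨hzi.1, by linarith⟩
        · rw [if_neg hik]
          exact hzi
      · obtain ⟨j, -, rfl⟩ := Finset.mem_image.1 hz
        obtain ⟨j', -, rfl⟩ := Finset.mem_image.1 hw
        exact hsep _ (hyY j).1 _ (hyY j').1 hzw
    · rw [← Finset.card_image_of_injective (Hi k) hy]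
      refine card_le_of_slab (lo := fun i => if i = k then m else o i) (k := k) hδ hℓδ (by norm_num) (fun z hz i => ?_)
        (fun z hz w hw hzw => ?_)
      · obtain ⟨j, hj, rfl⟩ := Finset.mem_image.1 hz
        have hjk : m ≤ y j k := (Finset.mem_filter.1 hj).2
        have hzi := (hyY j).2 i
        by_cases hik : i = k
        · subst hik
          rw [if_pos rfl, if_pos rfl]
          rw [hoi, hℓ] at hzi
          exact ⟨hjk, by linarith [hzi.2]⟩
        · rw [if_neg hik, if_neg hik]
          exact hzi
      · obtain ⟨j, -, rfl⟩ := Finset.mem_image.1 hz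
        obtain ⟨j', -, rfl⟩ := Finset.mem_image.1 hw
        exact hsep _ (hyY j).1 _ (hyY j').1 hzw
  have h1 : (offCount δ 2 y : ℝ) = Off.card := by
    rw [offCount, Nat.card_eq_fintype_card, Fintype.card_subtype]
  have h2 : (Off.card : ℝ) ≤ ∑ k : Fin 3, (((Lo k).card : ℝ) + (Hi k).card) := by
    have h := (Finset.card_le_card hcov6).trans Finset.card_biUnion_le
    have h' : (Off.card : ℝ) ≤ ∑ k : Fin 3, ((Lo k ∪ Hi k).card : ℝ) := by exact_mod_cast h
    refine h'.trans (Finset.sum_le_sum (fun k _ => ?_))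
    exact_mod_cast Finset.card_union_le _ _
  have h3 : ∑ k : Fin 3, (((Lo k).card : ℝ) + (Hi k).card) ≤ ∑ _k : Fin 3, (2 * ((2 * 2 / δ + 1) * (3 * ℓ / δ) ^ 2)) :=
    Finset.sum_le_sum (fun k _ => by linarith [(hslab k).1, (hslab k).2])
  rw [Finset.sum_const, Finset.card_univ, Fintype.card_fin, nsmul_eq_mul] at h3
  have h4 : ((3 : ℕ) : ℝ) * (2 * ((2 * 2 / δ + 1) * (3 * ℓ / δ) ^ 2)) = 54 * (4 / δ + 1) / δ ^ 2 * ℓ ^ 2 := by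
    push_cast
    field_simp
    ring
  calc (offCount δ 2 y : ℝ) = Off.card := h1
    _ ≤ _ := h2
    _ ≤ _ := h3
    _ = _ := h4

end Summit.AtomisticToContinuum.Crystallization.Theorems.OverbindingBudgetMisfitWindowLayer
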